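import Literature.MathematicalPhysics.QuantumFieldTheory.Dimock2011to13.AnalyticityDomains
import Literature.MathematicalPhysics.QuantumFieldTheory.Dimock2015.AnalyticLipschitz

/-!
# Dimock, *The renormalization group according to Balaban* I, §4.4 LEMMA 17 (`\label{12}`) «|δE^+_k(X, φ, 𝒲_k)| ≤
# 𝒪(1)λ_k^{1/4−10ε}e^{−κd_M(X)}» ASSEMBLED: the `δV_k` half with every exponent counted, the analyticity disc «t𝒲_k ∈ ¼ℛ_k,
# φ + t𝒲_k ⊂ ¾ℛ_k for |t| ≤ ¼λ_k^{−1/4}» PROVED on the tree's `ℛ_k`, and the Cauchy bound (take1) with `𝒪(1) = 8` — the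
# analyticity of `t ↦ E_k(X, φ + t𝒲_k)` and `‖E_k‖_{k,κ} ≤ 1` staying the hypotheses they are in the printed proof

**Citation header (reproduction of PUBLISHED work; template of the Bałaban lattice Yang–Mills cell).**
J. Dimock, *The renormalization group according to Balaban I. Small fields*, Rev. Math. Phys. **25** (2013) 1330010
(= arXiv:1108.1335v2) [Dimock2013], §4.4 `\subsection{fluctuation integral}` (TeX L2217): LEMMA 17 `\label{12}` (= Lemma 17 of the source's
global counter; #16 = `\label{11}` L2187, #17 = `\label{12}` L2283) L2283–2288 with its proof L2291–2325 — the `δV_k` half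
L2291–2310, the disc sentence L2313–2314, the contour formula and (take1) L2315–2327 — and the reblocking remark (take2)
L2332–2338; the inputs it quotes: §3.2 DEFINITION `ℛ_k` L1230–1240 and §4.3 LEMMA 16 «𝒲_k ∈ λ_k^{1/4}ℛ_k» L2187–2193.  TeX line
numbers refer to the arXiv source held by the cell (`inputs/files/dimock/src/1108.1335/1108.1335.tex`, 4263 lines, sha256[:16]
7382e6540dded9be); every quotation below was read there this session.  Dimock's papers are published and refereed and are
the cell's TEMPLATE, not manuscripts under audit; no quantity of the Bałaban series is touched.

**What the paper prints (verbatim, TeX → Unicode).**  LEMMA 17 (L2283–2288): *"For φ ∈ ½ℛ_k and |W| ≤ p_{0,k}.  |δE^+_k(X, φ,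
𝒲_k)| ≤ 𝒪(1)λ_k^{1/4−10ε}e^{−κd_M(X)}  (unsung)"*.  Proof (L2291–2325): *"We have δE^+_k = δE_k − δV_k and we first consider δV_k.
We have  δV_k(□) = ¼λ_k∫_□[(φ + 𝒲_k)⁴ − φ⁴] + ½μ_k∫_□[(φ + 𝒲_k)² − φ²]  Now |φ| ≤ ½λ_k^{−1/4−3ε} and |𝒲_k| ≤ p_k so the first term has a
contribution  |2λ_k∫_□φ³𝒲_k| ≤ 2M³·λ_k^{1/4−9ε}p_k ≤ λ_k^{1/4−10ε}  The other contributions to the first term are smaller. Similarly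
the second term has a contribution  |μ_k∫_□φ𝒲_k| ≤ λ_k^{1/2}M³·λ_k^{−1/4−3ε}p_k ≤ λ_k^{1/4−4ε}  The other term is smaller. Overall then
|δV_k(□)| ≤ 𝒪(1)λ_k^{1/4−10ε}.  By lemma 16 we have 𝒲_k ∈ λ_k^{1/4}ℛ_k. So if |t| ≤ λ_k^{−1/4}/4 then t𝒲_k ∈ ¼ℛ_k and φ + t𝒲_k ⊂ ¾ℛ_k.
The function t → E_k(φ + t𝒲_k) is analytic in this domain and so  δE_k(X, φ, 𝒲_k) = (1/2πi)∫_{|t| = λ_k^{−1/4}/4} dt/(t(t−1)) E_k(X, φ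
+ t𝒲_k)  Since  |E_k(X, φ + t𝒲_k)| ≤ ‖E_k‖_{k,κ}e^{−κd_M(X)} ≤ e^{−κd_M(X)}  this gives the bound  |δE_k(X, φ, 𝒲_k)| ≤
𝒪(1)λ_k^{1/4}e^{−κd_M(X)}  (take1)  which is sufficient."*

**Why this module.**  TEMPLATE.md §4.1 row «D1 §4.4 fluctuation integral Ξ_k, measure dμ*_k = N^{−1}χ^w dμ_I, ε_k^0 ≤ 𝒪(e^{−p²_{0,k}/2});
Lemma `\label{12}` |δE^+(X)| ≤ 𝒪(1)λ^{1/4−10ε}e^{−κd_M} (L2217–2338)» had ONE kernel object, `FluctuationNormalizer` (the `ε_k^0`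
bound); LEMMA 17 — the small factor `λ_k^{1/4−10ε}` of the whole small-field step, consumed by (osprey) and by THEOREM `lanky`'s
bounds (`SmallFieldStepAssembly.bb2_of_osprey`) — had none.  Its proof is bookkeeping over three inputs: the domain `ℛ_k` and
LEMMA 16's «𝒲_k ∈ λ_k^{1/4}ℛ_k» (kernel since this gen: `AnalyticityDomains.RDomain`, `calW_mem_rDomain`), the analyticity of `E_k(X,
·)` on `ℛ_k` with `‖E_k‖_{k,κ} ≤ 1` (the inductive hypothesis of THEOREM `lanky`), and the Cauchy difference formula (kernel:
`Dimock2015.AnalyticLipschitz.difference_formula` ∕ `norm_sub_le_div_of_bound_sphere`).  This module assembles it: the `δV_k`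
half with every exponent counted, the disc statement proved on the tree's `ℛ_k`, and (take1) with its `𝒪(1)` displayed.

**What is reproduced here (kernel-checked, zero `sorry`).**
* Part 1 — `δV_k` (L2291–2310): **`norm_pow_four_sub_le`** (`‖(φ+w)⁴ − φ⁴‖ ≤ 15a³b` for `‖φ‖ ≤ a`, `‖w‖ ≤ b ≤ a`: all four
  contributions, not only the displayed `4φ³w`), **`norm_sq_sub_le`** (`‖(φ+w)² − φ²‖ ≤ 3ab`), **`norm_deltaV_density_le`** (the
  one-site density `¼λ[(φ+w)⁴ − φ⁴] + ½μ[(φ+w)² − φ²]` bounded by `(15/4)λa³b + (3/2)|μ|ab`), **`deltaV_exponents`** (at `a =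
  ½λ^{−1/4−3ε}`, `b = p_k`, `|μ_k| ≤ λ_k^{1/2}`: `≤ (15/32 + 3/4)λ_k^{1/4−9ε}p_k` — the printed exponents `1/4 − 9ε` and `1/4 − 3ε ≤`),
  **`deltaV_cube_le`** (summing over the `N = M³` sites of a cube: `≤ K·λ_k^{1/4−10ε}` once `N·p_k ≤ λ_k^{−ε}` — the printed
  absorption *"2M³·λ_k^{1/4−9ε}p_k ≤ λ_k^{1/4−10ε}"* made explicit).
* Part 2 — THE DISC (L2313–2314), complex-valued fields on the tree's `ℤ^d` block carrier: **`rDomain_const_mul`** (`𝒲 ∈ cℛ_k`,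
  `|t| ≤ T`, `T > 0` ⟹ `t𝒲 ∈ (Tc)ℛ_k`), **`lemma17_domain`** (`φ ∈ ½ℛ_k`, `𝒲_k ∈ λ_k^{1/4}ℛ_k`, `|t| ≤ ¼λ_k^{−1/4}` ⟹ `t𝒲_k ∈ ¼ℛ_k`
  and `φ + t𝒲_k ∈ ¾ℛ_k`).
* Part 3 — (take1) (L2315–2324) for values in any complex Banach space `F`: `two_le_radius` (`ρ = ¼λ^{−1/4} ≥ 2 ⟸ λ^{1/4} ≤ ⅛`),
  **`take1`** (`f` complex differentiable on the closed disc of radius `¼λ^{−1/4}`, `‖f‖ ≤ M` on the circle ⟹ `‖f(1) − f(0)‖ ≤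
  8λ^{1/4}M` — `𝒪(1) = 8`), **`take1_decay`** (`M = ‖E_k‖e^{−κd_M(X)}`, `‖E_k‖ ≤ 1`), **`unsung`** (the two halves: `‖δE_k − δV_k‖ ≤ (8 +
  K_V)λ_k^{1/4−10ε}e^{−κd_M(X)}` for `λ_k ≤ 1`, `ε ≥ 0`).
* Part 4 (v1.1) — PART II's STEP (A) ([Dimock2013BalabanII] §3.13 LEMMA 3.15 `\label{first}` proof (A), arXiv:1212.5562v2 TeX
  L4500–4523: *"We argue as in lemma 17 of Part I"*): the same two halves on the circle `|t| = λ_k^{−1/4}` (no factor `¼`) with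
  the large-field induction hypothesis `|E_k(X, φ)| ≤ λ_k^β e^{−κd_M(X)}` — **`deltaV_exponents_scaled`** (the `δV_k` count at `a =
  cλ_k^{−1/4−3ε}`, `b = CB_wp_k`: *"We had a sharper bound on W_k there, but the argument still holds"*), `two_le_radius_II` (`ρ =
  λ^{−1/4} ≥ 2 ⟸ λ^{1/4} ≤ ½`), **`stepA_cauchy`** (`‖f(1) − f(0)‖ ≤ 2λ^{1/4}M`), **`stepA_deltaE`** (`M = λ^βe^{−κd_M(X)}`: `≤ 2λ_k^{1/4+β}
  e^{−κd_M(X)}` — the print's `𝒪(1)λ_k^{1/4+β}e^{−κd_M(X)}` with `𝒪(1) = 2`), **`stepA_bound`** (*"Altogether then |δE^+_k(X, φ,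
  𝒲_{k,Ω′})| ≤ 𝒪(1)λ_k^{1/4−10ε}e^{−κd_M(X)}"*: `≤ (2 + K_V)λ_k^{1/4−10ε}e^{−κd_M(X)}` for `λ_k ≤ 1`, `β, ε ≥ 0`); the disc `φ⁰ + t𝒲 ∈ ℛ_k`
  for `|t| ≤ λ_k^{−1/4}` on which the analyticity hypothesis is asserted is `AnalyticityDomains.disc_subset_rDomain` (v1.3).
* Non-vacuity: `λ = 1/4096` satisfies the radius smallness of Part 3, `λ = 1/16` that of Part 4.

**Readings ∕ divergences (declared).**  (i) Fields are complex-valued functions on the tree's `ℤ^d` fine sites (`X d → ℂ`), the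
domain `ℛ_k` is `AnalyticityDomains.RDomain` (reading (viii) there: Hölder quotient multiplicative, sup distance in block units,
strict `<`); `t𝒲 = fun y ↦ t·𝒲 y`.  (ii) The analyticity of `t ↦ E_k(X, φ + t𝒲_k)` on the closed disc is the hypothesis `hf` of
`take1` (the print: *"The function t → E_k(φ + t𝒲_k) is analytic in this domain"*, from `E_k ∈ 𝒦_k` analytic on `ℛ_k`; the
field space over the infinite carrier `ℤ^d` is not given a complex structure here — the disc statement `lemma17_domain` is what
the tree's carrier can say); `‖E_k‖_{k,κ} ≤ 1` enters as `nE ≤ 1` with the circle bound `nE·e^{−κd_M(X)}`.  (iii) Constants: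
`𝒪(1) = 8` in (take1) (from `M/(ρ−1) ≤ 2M/ρ` at `ρ = ¼λ^{−1/4} ≥ 2`, i.e. `λ_k ≤ 8^{−4}`); the `δV_k` constant `15/32 + 3/4`
per site before the `M³` count; *"λ_k sufficiently small (depending on M)"* = `M³p_k ≤ λ_k^{−ε}`; `|μ_k| ≤ λ_k^{1/2}` as printed
(THEOREM `lanky` prints the same hypothesis *"|μ_k| ≤ λ_k^{1/2}"*, L1927 — the bound LEMMA 17 uses at L2306; §5's candidate-solution
region `|μ_k| ≤ λ_k^{1/2+β}`, L2801–2809 ∕ L2848, tree `SmallFieldFlow`, is stronger; v1.1.1 DOCFIX of the v1∕v1.1 gloss, which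
attributed `λ_k^{1/2+β}` to THEOREM `lanky`).  (iv) `δV_k(□)` is a finite sum over an abstract index set of
sites with the one-site density; the fine-lattice volume factor `η³` and the identification `N = M³` (unit volume of an
`M`-cube) are left to the user (`deltaV_cube_le` takes `N = cube.card`).  (v) (unsung) is assembled for one polymer `X` from
the two displayed halves; that `δV_k` is supported on single cubes (`d_M(□) = 0`) is how the print combines them (L2291,
L2310) — here the hypothesis `hV` carries the factor `e^{−κd_M(X)}` (= 1 on cubes).

**What is NOT claimed.**  LEMMA 16 ((wbounds), `|𝒲_k| ≤ p_k`; its kernel inputs are `CovarianceSquareRoot` and (gk2)), the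
analyticity of `E_k` and the norm `‖·‖_{k,κ}`, the reblocking (take2) L2332–2338 (= `Reblocking` ∕ LEMMA `citizen`), §4.5's
localization of `(δE^+_k)′` in `W`, (osprey), anything of B1–B16 (TEMPLATE.md §4.1 row «D1 §4.4» ↔ B12 Thm 3's fluctuation
step ∕ B13 §1 — the row's Bałaban side untouched, grade unchanged).  NOT summit progress; NOT a statement about any Bałaban
paper; NOT continuum; NOT Clay.  NEW leaf; imports this lineage's `AnalyticityDomains` (⟶ `RedundantCharacteristicFunctions` …)
and `Dimock2015.AnalyticLipschitz` (Mathlib-only leaf); no Summits import; no cycle; modifies nothing; no named fact (net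
debt 0).  Unit `b2b-balaban-template` gen 39 round 5 (journal CLAIM D1-LEMMA17-KERNEL); cell records TEMPLATE.md §4.1 row «D1
§4.4»; GAPS C-tmpl39-5.

**Version.**  v1 (gen 39 round 5, literature-prover-b2b-balaban-template-g39-0, 2026-08-20) Parts 1–3.  v1.1 (gen 39 round 6, same
seat, 2026-08-20): Part 4 appended (part II LEMMA 3.15 step (A); source J. Dimock, *The renormalization group according to
Balaban II. Large fields*, J. Math. Phys. **54** (2013) 092301 = arXiv:1212.5562v2 [Dimock2013BalabanII], TeX source held by the
cell as `inputs/files/dimock/src/1212.5562/1212.5562.tex`, 7217 lines, sha256[:16] 75c5792fc48eacbc, §3.13 `\subsection{localization}`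
L4445, LEMMA 3.15 `\label{first}` L4456–4482, Remarks L4486–4496, proof (A) L4498–4535 — read there this session); APPEND-ONLY
(Parts 1–3 byte-identical in code; this header extended).  NOT CLAIMED from (A): the analyticity of `E_k` on `ℛ_k` (hypothesis
`hf`), the bounds (twoone1)∕(around)∕(somewhat) on `𝒲_{k,Ω′}`, the reblocking (twinkie) L4527–4535, steps (B)–(F).  v1.1.1 (gen 40,
literature-prover-b2b-balaban-template-g40-0, 2026-08-20): DOCFIX-LOW of Readings (iii) taken from the outside cross-read of v1
(cell journal l.18443, GAPS C-ne9leaf03g23-1; v1.1 cross-read l.18536, C-ne9leaf03g23-2: nothing further): docstring text only,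
every declaration and proof byte-identical to v1.1; step (F)'s summation now lives in the sibling `LocalizationSumDecay`
(gen 40), the reblocking (take2)∕(twinkie) is `Reblocking.norm_reblock_le` by name.
-/

noncomputable section

open Finset Metric
open Literature.MathematicalPhysics.QuantumFieldTheory.Balaban1983to89.B6QGQLower276
open Literature.MathematicalPhysics.QuantumFieldTheory.Dimock2011to13.AnalyticityDomains
open Literature.MathematicalPhysics.QuantumFieldTheory.Dimock2015 (norm_sub_le_div_of_bound_sphere difference_formula)

namespace Literature.MathematicalPhysics.QuantumFieldTheory.Dimock2011to13.FluctuationShiftBound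

variable {d : ℕ}

/-! ## Part 1. `δV_k`: the potential shifted by the fluctuation field, pointwise (L2292–2310) -/

/-- the quartic difference: `‖(φ + w)⁴ − φ⁴‖ ≤ 15a³b` for `‖φ‖ ≤ a`, `‖w‖ ≤ b ≤ a` (*"the first term has a contribution |2λ_k∫_□φ³𝒲_k|
… The other contributions to the first term are smaller"*).
[cite: Dimock2013, part I §4.4 Lemma 17 (label 12) proof L2292–2303 (arXiv:1108.1335v2 TeX)] -/
theorem norm_pow_four_sub_le {φ w : ℂ} {a b : ℝ} (hφ : ‖φ‖ ≤ a) (hw : ‖w‖ ≤ b) (hba : b ≤ a) :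
    ‖(φ + w) ^ 4 - φ ^ 4‖ ≤ 15 * a ^ 3 * b := by
  have ha : 0 ≤ a := (norm_nonneg _).trans hφ
  have hb : 0 ≤ b := (norm_nonneg _).trans hw
  have e1 : (φ + w) ^ 4 - φ ^ 4 = w * (4 * φ ^ 3 + 6 * φ ^ 2 * w + 4 * φ * w ^ 2 + w ^ 3) := by ring
  rw [e1, norm_mul]
  have h2 : ‖4 * φ ^ 3 + 6 * φ ^ 2 * w + 4 * φ * w ^ 2 + w ^ 3‖ ≤ 15 * a ^ 3 := by
    have p1 : ‖φ‖ ^ 3 ≤ a ^ 3 := pow_le_pow_left₀ (norm_nonneg _) hφ 3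
    have p2 : ‖φ‖ ^ 2 * ‖w‖ ≤ a ^ 3 :=
      calc ‖φ‖ ^ 2 * ‖w‖ ≤ a ^ 2 * b :=
            mul_le_mul (pow_le_pow_left₀ (norm_nonneg _) hφ 2) hw (norm_nonneg _) (by positivity)
        _ ≤ a ^ 2 * a := mul_le_mul_of_nonneg_left hba (by positivity)
        _ = a ^ 3 := by ring
    have p3 : ‖φ‖ * ‖w‖ ^ 2 ≤ a ^ 3 :=
      calc ‖φ‖ * ‖w‖ ^ 2 ≤ a * b ^ 2 := mul_le_mul hφ (pow_le_pow_left₀ (norm_nonneg _) hw 2) (by positivity) ha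
        _ ≤ a * a ^ 2 := mul_le_mul_of_nonneg_left (pow_le_pow_left₀ hb hba 2) ha
        _ = a ^ 3 := by ring
    have p4 : ‖w‖ ^ 3 ≤ a ^ 3 := (pow_le_pow_left₀ (norm_nonneg _) hw 3).trans (pow_le_pow_left₀ hb hba 3)
    have t1 : ‖4 * φ ^ 3‖ = 4 * ‖φ‖ ^ 3 := by simp [norm_pow]
    have t2 : ‖6 * φ ^ 2 * w‖ = 6 * (‖φ‖ ^ 2 * ‖w‖) := by simp [norm_pow]; ring
    have t3 : ‖4 * φ * w ^ 2‖ = 4 * (‖φ‖ * ‖w‖ ^ 2) := by simp [norm_pow]; ring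
    have t4 : ‖w ^ 3‖ = ‖w‖ ^ 3 := norm_pow w 3
    calc ‖4 * φ ^ 3 + 6 * φ ^ 2 * w + 4 * φ * w ^ 2 + w ^ 3‖
        ≤ ‖4 * φ ^ 3‖ + ‖6 * φ ^ 2 * w‖ + ‖4 * φ * w ^ 2‖ + ‖w ^ 3‖ := by
          refine (norm_add_le _ _).trans (add_le_add ((norm_add_le _ _).trans (add_le_add (norm_add_le _ _) le_rfl)) le_rfl)
      _ ≤ 4 * a ^ 3 + 6 * a ^ 3 + 4 * a ^ 3 + a ^ 3 := by rw [t1, t2, t3, t4]; linarith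
      _ = 15 * a ^ 3 := by ring
  calc ‖w‖ * ‖4 * φ ^ 3 + 6 * φ ^ 2 * w + 4 * φ * w ^ 2 + w ^ 3‖ ≤ b * (15 * a ^ 3) :=
      mul_le_mul hw h2 (norm_nonneg _) hb
    _ = 15 * a ^ 3 * b := by ring

/-- the quadratic difference: `‖(φ + w)² − φ²‖ ≤ 3ab` for `‖φ‖ ≤ a`, `‖w‖ ≤ b ≤ a` (*"Similarly the second term has a contribution
|μ_k∫_□φ𝒲_k| … The other term is smaller"*). [cite: Dimock2013, part I §4.4 Lemma 17 (label 12) proof L2304–2309 (arXiv:1108.1335v2 TeX)] -/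
theorem norm_sq_sub_le {φ w : ℂ} {a b : ℝ} (hφ : ‖φ‖ ≤ a) (hw : ‖w‖ ≤ b) (hba : b ≤ a) :
    ‖(φ + w) ^ 2 - φ ^ 2‖ ≤ 3 * a * b := by
  have hb : 0 ≤ b := (norm_nonneg _).trans hw
  have e1 : (φ + w) ^ 2 - φ ^ 2 = w * (2 * φ + w) := by ring
  rw [e1, norm_mul]
  have h2 : ‖2 * φ + w‖ ≤ 3 * a := by
    calc ‖2 * φ + w‖ ≤ ‖2 * φ‖ + ‖w‖ := norm_add_le _ _
      _ ≤ 2 * a + a := by rw [norm_mul]; norm_num; linarith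
      _ = 3 * a := by ring
  calc ‖w‖ * ‖2 * φ + w‖ ≤ b * (3 * a) := mul_le_mul hw h2 (norm_nonneg _) hb
    _ = 3 * a * b := by ring

/-- **THE DENSITY OF `δV_k` AT ONE SITE** (L2292–2310): `δV_k` has density `¼λ_k[(φ+𝒲)⁴ − φ⁴] + ½μ_k[(φ+𝒲)² − φ²]`; with `‖φ‖ ≤ a`,
`‖𝒲‖ ≤ b ≤ a`, `0 ≤ λ_k` it is bounded by `(15/4)λ_ka³b + (3/2)|μ_k|ab`.
[cite: Dimock2013, part I §4.4 Lemma 17 (label 12) proof L2292–2310 (arXiv:1108.1335v2 TeX)] -/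
theorem norm_deltaV_density_le {φ w : ℂ} {a b lam μ : ℝ} (hlam : 0 ≤ lam) (hφ : ‖φ‖ ≤ a) (hw : ‖w‖ ≤ b)
    (hba : b ≤ a) :
    ‖(lam / 4 : ℂ) * ((φ + w) ^ 4 - φ ^ 4) + (μ / 2 : ℂ) * ((φ + w) ^ 2 - φ ^ 2)‖
      ≤ 15 / 4 * lam * a ^ 3 * b + 3 / 2 * |μ| * a * b := by
  have h4 := norm_pow_four_sub_le hφ hw hba
  have h2 := norm_sq_sub_le hφ hw hba
  have n1 : ‖(lam / 4 : ℂ)‖ = lam / 4 := by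
    rw [show (lam / 4 : ℂ) = ((lam / 4 : ℝ) : ℂ) by push_cast; ring, Complex.norm_real, Real.norm_of_nonneg (by linarith)]
  have n2 : ‖(μ / 2 : ℂ)‖ = |μ| / 2 := by
    rw [show (μ / 2 : ℂ) = ((μ / 2 : ℝ) : ℂ) by push_cast; ring, Complex.norm_real, Real.norm_eq_abs, abs_div,
      abs_of_pos (by norm_num : (0:ℝ) < 2)]
  calc ‖(lam / 4 : ℂ) * ((φ + w) ^ 4 - φ ^ 4) + (μ / 2 : ℂ) * ((φ + w) ^ 2 - φ ^ 2)‖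
      ≤ ‖(lam / 4 : ℂ) * ((φ + w) ^ 4 - φ ^ 4)‖ + ‖(μ / 2 : ℂ) * ((φ + w) ^ 2 - φ ^ 2)‖ := norm_add_le _ _
    _ = lam / 4 * ‖(φ + w) ^ 4 - φ ^ 4‖ + |μ| / 2 * ‖(φ + w) ^ 2 - φ ^ 2‖ := by rw [norm_mul, norm_mul, n1, n2]
    _ ≤ lam / 4 * (15 * a ^ 3 * b) + |μ| / 2 * (3 * a * b) :=
        add_le_add (mul_le_mul_of_nonneg_left h4 (by linarith)) (mul_le_mul_of_nonneg_left h2 (by positivity))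
    _ = 15 / 4 * lam * a ^ 3 * b + 3 / 2 * |μ| * a * b := by ring

/-- **THE PRINTED EXPONENT COUNT FOR `δV_k`** (L2299–2310 with `φ ∈ ½ℛ_k`, `|𝒲_k| ≤ p_k`, `|μ_k| ≤ λ_k^{1/2}`): at `a =
½λ_k^{−1/4−3ε}`, `b = p_k` the one-site bound is `(15/32)λ_k^{1/4−9ε}p_k + (3/4)|μ_k|λ_k^{−1/4−3ε}p_k ≤ (15/32 + 3/4)λ_k^{1/4−9ε}p_k` for
`|μ_k| ≤ λ_k^{1/2}`, `0 < λ_k ≤ 1`, `ε ≥ 0` (*"2M³·λ_k^{1/4−9ε}p_k"*, *"λ_k^{1/2}M³·λ_k^{−1/4−3ε}p_k ≤ λ_k^{1/4−4ε}"*: exponents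
`1 − 3(1/4+3ε) = 1/4 − 9ε` and `1/2 − 1/4 − 3ε = 1/4 − 3ε ≥ 1/4 − 9ε` in size for `λ ≤ 1`).
[cite: Dimock2013, part I §4.4 Lemma 17 (label 12) proof L2299–2310 (arXiv:1108.1335v2 TeX)] -/
theorem deltaV_exponents {lam ε μ pk : ℝ} (hlam : 0 < lam) (hlam1 : lam ≤ 1) (hε : 0 ≤ ε) (hpk : 0 ≤ pk)
    (hμ : |μ| ≤ lam ^ (1 / 2 : ℝ)) :
    15 / 4 * lam * (1 / 2 * lam ^ (-(1 / 4 + 3 * ε))) ^ 3 * pk + 3 / 2 * |μ| * (1 / 2 * lam ^ (-(1 / 4 + 3 * ε))) * pk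
      ≤ (15 / 32 + 3 / 4) * lam ^ (1 / 4 - 9 * ε) * pk := by
  have hq : 0 < lam ^ (-(1 / 4 + 3 * ε)) := Real.rpow_pos_of_pos hlam _
  -- the quartic term: λ·(λ^{−(1/4+3ε)})³ = λ^{1/4−9ε}
  have e3 : lam * (lam ^ (-(1 / 4 + 3 * ε))) ^ 3 = lam ^ (1 / 4 - 9 * ε) := by
    rw [← Real.rpow_natCast, ← Real.rpow_mul hlam.le, show ((3 : ℕ) : ℝ) = 3 by norm_num]
    rw [show lam * lam ^ (-(1 / 4 + 3 * ε) * 3) = lam ^ (1 : ℝ) * lam ^ (-(1 / 4 + 3 * ε) * 3) by rw [Real.rpow_one],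
      ← Real.rpow_add hlam]
    congr 1; ring
  -- the quadratic term: λ^{1/2}·λ^{−(1/4+3ε)} = λ^{1/4−3ε} ≤ λ^{1/4−9ε}
  have e2 : lam ^ (1 / 2 : ℝ) * lam ^ (-(1 / 4 + 3 * ε)) = lam ^ (1 / 4 - 3 * ε) := by
    rw [← Real.rpow_add hlam]; congr 1; ring
  have hle : lam ^ (1 / 4 - 3 * ε) ≤ lam ^ (1 / 4 - 9 * ε) :=
    Real.rpow_le_rpow_of_exponent_ge hlam hlam1 (by linarith)
  have A : 15 / 4 * lam * (1 / 2 * lam ^ (-(1 / 4 + 3 * ε))) ^ 3 * pk = 15 / 32 * lam ^ (1 / 4 - 9 * ε) * pk := by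
    rw [mul_pow, ← e3]; ring
  have B : 3 / 2 * |μ| * (1 / 2 * lam ^ (-(1 / 4 + 3 * ε))) * pk ≤ 3 / 4 * lam ^ (1 / 4 - 9 * ε) * pk := by
    have h1 : |μ| * lam ^ (-(1 / 4 + 3 * ε)) ≤ lam ^ (1 / 4 - 9 * ε) := by
      calc |μ| * lam ^ (-(1 / 4 + 3 * ε)) ≤ lam ^ (1 / 2 : ℝ) * lam ^ (-(1 / 4 + 3 * ε)) :=
          mul_le_mul_of_nonneg_right hμ hq.le
        _ = lam ^ (1 / 4 - 3 * ε) := e2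
        _ ≤ lam ^ (1 / 4 - 9 * ε) := hle
    have h2 : 3 / 2 * |μ| * (1 / 2 * lam ^ (-(1 / 4 + 3 * ε))) * pk = 3 / 4 * (|μ| * lam ^ (-(1 / 4 + 3 * ε))) * pk := by
      ring
    rw [h2]
    exact mul_le_mul_of_nonneg_right (mul_le_mul_of_nonneg_left h1 (by norm_num)) hpk
  rw [A]
  linarith

/-- **`δV_k` OF A CUBE** (L2299–2310: *"… ≤ 2M³·λ_k^{1/4−9ε}p_k ≤ λ_k^{1/4−10ε} … Overall then |δV_k(□)| ≤ 𝒪(1)λ_k^{1/4−10ε}"*): summing a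
one-site bound `Kλ_k^{1/4−9ε}p_k` over a cube of `N` sites (print `N = M³`) gives `N·K·λ_k^{1/4−9ε}p_k ≤ K·λ_k^{1/4−10ε}` as soon as
`N·p_k ≤ λ_k^{−ε}` — the printed absorption *"2M³·λ_k^{1/4−9ε}p_k ≤ λ_k^{1/4−10ε}"* (λ_k small depending on M) made explicit.
[cite: Dimock2013, part I §4.4 Lemma 17 (label 12) proof L2299–2310 (arXiv:1108.1335v2 TeX)] -/
theorem deltaV_cube_le {ι : Type*} (cube : Finset ι) (v : ι → ℂ) {K lam ε pk : ℝ} (hlam : 0 < lam) (hK : 0 ≤ K)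
    (hv : ∀ i ∈ cube, ‖v i‖ ≤ K * lam ^ (1 / 4 - 9 * ε) * pk)
    (hsmall : (cube.card : ℝ) * pk ≤ lam ^ (-ε)) :
    ‖∑ i ∈ cube, v i‖ ≤ K * lam ^ (1 / 4 - 10 * ε) := by
  have hq : 0 < lam ^ (1 / 4 - 9 * ε) := Real.rpow_pos_of_pos hlam _
  have e1 : lam ^ (1 / 4 - 9 * ε) * lam ^ (-ε) = lam ^ (1 / 4 - 10 * ε) := by
    rw [← Real.rpow_add hlam]; congr 1; ring
  calc ‖∑ i ∈ cube, v i‖ ≤ ∑ i ∈ cube, ‖v i‖ := norm_sum_le _ _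
    _ ≤ ∑ _i ∈ cube, K * lam ^ (1 / 4 - 9 * ε) * pk := Finset.sum_le_sum hv
    _ = K * lam ^ (1 / 4 - 9 * ε) * ((cube.card : ℝ) * pk) := by
        rw [Finset.sum_const, nsmul_eq_mul]; ring
    _ ≤ K * lam ^ (1 / 4 - 9 * ε) * lam ^ (-ε) :=
        mul_le_mul_of_nonneg_left hsmall (mul_nonneg hK hq.le)
    _ = K * lam ^ (1 / 4 - 10 * ε) := by rw [mul_assoc, e1]

/-! ## Part 2. The analyticity disc of LEMMA 17: `𝒲_k ∈ λ_k^{1/4}ℛ_k`, `|t| ≤ ¼λ_k^{−1/4}` ⟹ `t𝒲_k ∈ ¼ℛ_k`, `φ + t𝒲_k ∈ ¾ℛ_k` -/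

section Disc

variable {n : ℕ} {S : Finset (X d)}

/-- **A COMPLEX MULTIPLE OF A FIELD IN `cℛ_k` IS IN `(Tc)ℛ_k` FOR `|t| ≤ T`** (`T > 0`): all three bounds of (rk) are seminorm
bounds, `‖t·φ‖ = |t|‖φ‖`. [cite: Dimock2013, part I §4.4 Lemma 17 (label 12) proof L2313–2314 (arXiv:1108.1335v2 TeX)] -/
theorem rDomain_const_mul {c T lam ε αH : ℝ} {t : ℂ} {W : X d → ℂ} (hT : 0 < T) (ht : ‖t‖ ≤ T)
    (h : RDomain n c lam ε αH S W) : RDomain n (T * c) lam ε αH S (fun y => t * W y) := by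
  have key : ∀ {z : ℂ} {q : ℝ}, ‖z‖ < q → ‖t * z‖ < T * q := by
    intro z q hz
    have hq : 0 < q := (norm_nonneg z).trans_lt hz
    rw [norm_mul]
    calc ‖t‖ * ‖z‖ ≤ T * ‖z‖ := mul_le_mul_of_nonneg_right ht (norm_nonneg z)
      _ < T * q := mul_lt_mul_of_pos_left hz hT
  refine ⟨fun x hx => ?_, fun μ x hx hxe => ?_, fun μ x hx x' hx' hxe hxe' hne hdist => ?_⟩
  · rw [mul_assoc]; exact key (h.1 x hx)
  · rw [fdFineV_const_mul, mul_assoc]; exact key (h.2.1 μ x hx hxe)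
  · rw [fdFineV_const_mul, fdFineV_const_mul, ← mul_sub, mul_assoc, mul_assoc]
    have h3 := h.2.2 μ x hx x' hx' hxe hxe' hne hdist
    rw [mul_assoc] at h3
    exact key h3

/-- **LEMMA 17's DOMAIN STATEMENT** (L2313–2314: *"By lemma 16 we have 𝒲_k ∈ λ_k^{1/4}ℛ_k. So if |t| ≤ λ_k^{−1/4}/4 then t𝒲_k ∈ ¼ℛ_k
and φ + t𝒲_k ⊂ ¾ℛ_k"*): for `φ ∈ ½ℛ_k` (the lemma's hypothesis) and `𝒲_k ∈ λ_k^{1/4}ℛ_k` (`AnalyticityDomains.calW_mem_rDomain`).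
[cite: Dimock2013, part I §4.4 Lemma 17 (label 12) L2283–2288 with proof L2313–2314 (arXiv:1108.1335v2 TeX)] -/
theorem lemma17_domain {lam ε αH : ℝ} {φ W : X d → ℂ} (hlam : 0 < lam) (hφ : RDomain n (1 / 2) lam ε αH S φ)
    (hW : RDomain n (lam ^ (1 / 4 : ℝ)) lam ε αH S W) {t : ℂ} (ht : ‖t‖ ≤ lam ^ (-(1 / 4 : ℝ)) / 4) :
    RDomain n (1 / 4) lam ε αH S (fun y => t * W y) ∧ RDomain n (3 / 4) lam ε αH S (φ + fun y => t * W y) := by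
  have hT : 0 < lam ^ (-(1 / 4 : ℝ)) / 4 := div_pos (Real.rpow_pos_of_pos hlam _) (by norm_num)
  have h1 := rDomain_const_mul hT ht hW
  have e1 : lam ^ (-(1 / 4 : ℝ)) / 4 * lam ^ (1 / 4 : ℝ) = 1 / 4 := by
    rw [div_mul_eq_mul_div, ← Real.rpow_add hlam]; norm_num
  rw [e1] at h1
  refine ⟨h1, ?_⟩
  have h2 := rDomain_add hφ h1
  norm_num at h2
  exact h2

end Disc

/-! ## Part 3. (take1): the Cauchy bound on `δE_k(X, φ, 𝒲_k) = E_k(X, φ + 𝒲_k) − E_k(X, φ)` over the circle `|t| = ¼λ_k^{−1/4}` -/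

section Take1

variable {F : Type*} [NormedAddCommGroup F] [NormedSpace ℂ F] [CompleteSpace F]

/-- the radius `ρ = ¼λ_k^{−1/4}` is at least `2` iff `λ_k ≤ 8^{−4} = 1/4096` (*"λ_k sufficiently small"*); here the sufficient
direction from `λ_k^{1/4} ≤ 1/8`. [cite: Dimock2013, part I §4.4 Lemma 17 (label 12) proof L2313–2318 (arXiv:1108.1335v2 TeX)] -/
theorem two_le_radius {lam : ℝ} (hlam : 0 < lam) (hsmall : lam ^ (1 / 4 : ℝ) ≤ 1 / 8) :
    2 ≤ lam ^ (-(1 / 4 : ℝ)) / 4 := by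
  have hq : 0 < lam ^ (1 / 4 : ℝ) := Real.rpow_pos_of_pos hlam _
  rw [Real.rpow_neg hlam.le, le_div_iff₀ (by norm_num : (0:ℝ) < 4), ← one_div, le_div_iff₀ hq]
  linarith

/-- **(take1)** (L2315–2324: *"The function t → E_k(φ + t𝒲_k) is analytic in this domain and so  δE_k(X, φ, 𝒲_k) = (1/2πi)
∫_{|t| = λ_k^{−1/4}/4} dt/(t(t−1)) E_k(X, φ + t𝒲_k)  Since |E_k(X, φ + t𝒲_k)| ≤ ‖E_k‖_{k,κ}e^{−κd_M(X)} ≤ e^{−κd_M(X)} this gives the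
bound  |δE_k(X, φ, 𝒲_k)| ≤ 𝒪(1)λ_k^{1/4}e^{−κd_M(X)}"*): for `f = t ↦ E_k(X, φ + t𝒲_k)` complex differentiable on the closed disc of
radius `ρ = ¼λ_k^{−1/4} ≥ 2` and bounded by `M` (= `‖E_k‖_{k,κ}e^{−κd_M(X)}`) on the circle, `‖f(1) − f(0)‖ ≤ 8λ_k^{1/4}·M` — the
print's `𝒪(1) = 8` (from the tree's `Dimock2015.norm_sub_le_div_of_bound_sphere`: `M/(ρ−1) ≤ 2M/ρ`); analyticity is the hypothesis
`hf` (its domain content is `lemma17_domain`). [cite: Dimock2013, part I §4.4 Lemma 17 (label 12) eq. (take1) L2313–2324 (arXiv:1108.1335v2 TeX)] -/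
theorem take1 {f : ℂ → F} {lam M : ℝ} (hlam : 0 < lam) (hsmall : lam ^ (1 / 4 : ℝ) ≤ 1 / 8)
    (hf : DifferentiableOn ℂ f (closedBall 0 (lam ^ (-(1 / 4 : ℝ)) / 4)))
    (hM : ∀ t ∈ sphere (0 : ℂ) (lam ^ (-(1 / 4 : ℝ)) / 4), ‖f t‖ ≤ M) :
    ‖f 1 - f 0‖ ≤ 8 * lam ^ (1 / 4 : ℝ) * M := by
  set ρ := lam ^ (-(1 / 4 : ℝ)) / 4 with hρ
  have h2 : 2 ≤ ρ := two_le_radius hlam hsmall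
  have hρ1 : 1 < ρ := by linarith
  have hM0 : 0 ≤ M := by
    have hmem : ((ρ : ℝ) : ℂ) ∈ sphere (0 : ℂ) ρ := by
      rw [mem_sphere, dist_zero_right, Complex.norm_real, Real.norm_eq_abs, abs_of_pos (by linarith)]
    exact (norm_nonneg _).trans (hM _ hmem)
  have h3 : ‖f 1 - f 0‖ ≤ M / (ρ - 1) := norm_sub_le_div_of_bound_sphere hρ1 hf hM
  -- `M/(ρ−1) ≤ 2M/ρ = 8λ^{1/4}M`
  have h4 : M / (ρ - 1) ≤ 2 * M / ρ := by
    rw [div_le_div_iff₀ (by linarith) (by linarith)]; nlinarith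
  have e5 : 2 * M / ρ = 8 * lam ^ (1 / 4 : ℝ) * M := by
    rw [hρ, Real.rpow_neg hlam.le]
    field_simp
    ring
  linarith [h4]

/-- (take1) with the decay factor displayed: `M = ‖E_k‖·e^{−κd_M(X)}` and `‖E_k‖ ≤ 1` give `‖δE_k(X)‖ ≤ 8λ_k^{1/4}e^{−κd_M(X)}`.
[cite: Dimock2013, part I §4.4 Lemma 17 (label 12) eq. (take1) L2319–2324 (arXiv:1108.1335v2 TeX)] -/
theorem take1_decay {f : ℂ → F} {lam nE κ dM : ℝ} (hlam : 0 < lam) (hsmall : lam ^ (1 / 4 : ℝ) ≤ 1 / 8) (hnE : nE ≤ 1)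
    (hf : DifferentiableOn ℂ f (closedBall 0 (lam ^ (-(1 / 4 : ℝ)) / 4)))
    (hM : ∀ t ∈ sphere (0 : ℂ) (lam ^ (-(1 / 4 : ℝ)) / 4), ‖f t‖ ≤ nE * Real.exp (-κ * dM)) :
    ‖f 1 - f 0‖ ≤ 8 * lam ^ (1 / 4 : ℝ) * Real.exp (-κ * dM) := by
  have h1 := take1 hlam hsmall hf hM
  have hq : 0 ≤ 8 * lam ^ (1 / 4 : ℝ) := by positivity
  have h2 : nE * Real.exp (-κ * dM) ≤ Real.exp (-κ * dM) := by
    calc nE * Real.exp (-κ * dM) ≤ 1 * Real.exp (-κ * dM) :=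
        mul_le_mul_of_nonneg_right hnE (Real.exp_pos _).le
      _ = Real.exp (-κ * dM) := one_mul _
  exact h1.trans (by nlinarith [mul_le_mul_of_nonneg_left h2 hq])

omit [NormedSpace ℂ F] [CompleteSpace F] in
/-- **LEMMA 17 (unsung) ASSEMBLED from its two halves**: `δE^+_k = δE_k − δV_k` with `‖δE_k(X)‖ ≤ 8λ_k^{1/4}e^{−κd_M(X)}` ((take1)) and
`‖δV_k(X)‖ ≤ K_Vλ_k^{1/4−10ε}e^{−κd_M(X)}` (Part 1 for the cubes `X = □`, where `d_M(□) = 0`; `δV_k(X) = 0` otherwise) gives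
`‖δE^+_k(X)‖ ≤ (8 + K_V)λ_k^{1/4−10ε}e^{−κd_M(X)}` for `λ_k ≤ 1`, `ε ≥ 0` — *"|δE^+_k(X, φ, 𝒲_k)| ≤ 𝒪(1)λ_k^{1/4−10ε}e^{−κd_M(X)}"*.
[cite: Dimock2013, part I §4.4 Lemma 17 (label 12) eq. (unsung) L2283–2288, proof L2291 and L2324–2325 (arXiv:1108.1335v2 TeX)] -/
theorem unsung {δE δV : F} {lam ε κ dM KV : ℝ} (hlam : 0 < lam) (hlam1 : lam ≤ 1) (hε : 0 ≤ ε)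
    (hE : ‖δE‖ ≤ 8 * lam ^ (1 / 4 : ℝ) * Real.exp (-κ * dM))
    (hV : ‖δV‖ ≤ KV * lam ^ (1 / 4 - 10 * ε) * Real.exp (-κ * dM)) :
    ‖δE - δV‖ ≤ (8 + KV) * lam ^ (1 / 4 - 10 * ε) * Real.exp (-κ * dM) := by
  have hle : lam ^ (1 / 4 : ℝ) ≤ lam ^ (1 / 4 - 10 * ε) :=
    Real.rpow_le_rpow_of_exponent_ge hlam hlam1 (by linarith)
  have hexp : 0 ≤ Real.exp (-κ * dM) := (Real.exp_pos _).le
  calc ‖δE - δV‖ ≤ ‖δE‖ + ‖δV‖ := norm_sub_le _ _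
    _ ≤ 8 * lam ^ (1 / 4 : ℝ) * Real.exp (-κ * dM) + KV * lam ^ (1 / 4 - 10 * ε) * Real.exp (-κ * dM) := add_le_add hE hV
    _ ≤ 8 * lam ^ (1 / 4 - 10 * ε) * Real.exp (-κ * dM) + KV * lam ^ (1 / 4 - 10 * ε) * Real.exp (-κ * dM) := by
        nlinarith [mul_le_mul_of_nonneg_right hle hexp]
    _ = (8 + KV) * lam ^ (1 / 4 - 10 * ε) * Real.exp (-κ * dM) := by ring

end Take1

/-! ## Part 4 (v1.1). Part II, §3.13 LEMMA 3.15 step (A): the same argument on the circle `|t| = λ_k^{−1/4}` with the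
large-field induction hypothesis `|E_k(X, φ)| ≤ λ_k^β e^{−κd_M(X)}` -/

/-- **THE `δV_k` COUNT AT A SCALED RADIUS** (part II step (A), L4502–4506: *"The bounds |φ| ≤ λ_k^{−1/4−3ε} and |𝒲_{k,Ω′}| ≤ CB_wp_k
imply as in part I that |δV_k(□, φ, 𝒲_{k,Ω′})| ≤ λ_k^{1/4−10ε}. (We had a sharper bound on W_k there, but the argument stills
holds.)"*): at `a = cλ_k^{−1/4−3ε}` (`c ≥ 0`; part I uses `c = ½`, part II writes `c = 1`) and any `b ≥ 0` (part II: `b = CB_wp_k`)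
the one-site bound of `norm_deltaV_density_le` is `≤ (15/4·c³ + 3/2·c)λ_k^{1/4−9ε}b` for `|μ_k| ≤ λ_k^{1/2}`, `0 < λ_k ≤ 1`, `ε ≥ 0`;
`deltaV_cube_le` then absorbs `N·b ≤ λ_k^{−ε}`.
[cite: Dimock2013BalabanII, §3.13 Lemma 3.15 (label first) proof (A) L4502–4506 (arXiv:1212.5562v2 TeX); Dimock2013, part I §4.4 Lemma 17 proof L2299–2310] -/
theorem deltaV_exponents_scaled {lam ε μ b c : ℝ} (hlam : 0 < lam) (hlam1 : lam ≤ 1) (hε : 0 ≤ ε) (hb : 0 ≤ b)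
    (hc : 0 ≤ c) (hμ : |μ| ≤ lam ^ (1 / 2 : ℝ)) :
    15 / 4 * lam * (c * lam ^ (-(1 / 4 + 3 * ε))) ^ 3 * b + 3 / 2 * |μ| * (c * lam ^ (-(1 / 4 + 3 * ε))) * b
      ≤ (15 / 4 * c ^ 3 + 3 / 2 * c) * lam ^ (1 / 4 - 9 * ε) * b := by
  have hq : 0 < lam ^ (-(1 / 4 + 3 * ε)) := Real.rpow_pos_of_pos hlam _
  have e3 : lam * (lam ^ (-(1 / 4 + 3 * ε))) ^ 3 = lam ^ (1 / 4 - 9 * ε) := by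
    rw [← Real.rpow_natCast, ← Real.rpow_mul hlam.le, show ((3 : ℕ) : ℝ) = 3 by norm_num]
    rw [show lam * lam ^ (-(1 / 4 + 3 * ε) * 3) = lam ^ (1 : ℝ) * lam ^ (-(1 / 4 + 3 * ε) * 3) by rw [Real.rpow_one],
      ← Real.rpow_add hlam]
    congr 1; ring
  have e2 : lam ^ (1 / 2 : ℝ) * lam ^ (-(1 / 4 + 3 * ε)) = lam ^ (1 / 4 - 3 * ε) := by
    rw [← Real.rpow_add hlam]; congr 1; ring
  have hle : lam ^ (1 / 4 - 3 * ε) ≤ lam ^ (1 / 4 - 9 * ε) :=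
    Real.rpow_le_rpow_of_exponent_ge hlam hlam1 (by linarith)
  have A : 15 / 4 * lam * (c * lam ^ (-(1 / 4 + 3 * ε))) ^ 3 * b = 15 / 4 * c ^ 3 * lam ^ (1 / 4 - 9 * ε) * b := by
    rw [mul_pow, ← e3]; ring
  have h1 : |μ| * lam ^ (-(1 / 4 + 3 * ε)) ≤ lam ^ (1 / 4 - 9 * ε) := by
    calc |μ| * lam ^ (-(1 / 4 + 3 * ε)) ≤ lam ^ (1 / 2 : ℝ) * lam ^ (-(1 / 4 + 3 * ε)) :=
        mul_le_mul_of_nonneg_right hμ hq.le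
      _ = lam ^ (1 / 4 - 3 * ε) := e2
      _ ≤ lam ^ (1 / 4 - 9 * ε) := hle
  have B : 3 / 2 * |μ| * (c * lam ^ (-(1 / 4 + 3 * ε))) * b ≤ 3 / 2 * c * lam ^ (1 / 4 - 9 * ε) * b := by
    have h2 : 3 / 2 * |μ| * (c * lam ^ (-(1 / 4 + 3 * ε))) * b = 3 / 2 * c * (|μ| * lam ^ (-(1 / 4 + 3 * ε))) * b := by
      ring
    rw [h2]
    exact mul_le_mul_of_nonneg_right (mul_le_mul_of_nonneg_left h1 (by positivity)) hb
  rw [A]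
  linarith

section StepA

variable {F : Type*} [NormedAddCommGroup F] [NormedSpace ℂ F] [CompleteSpace F]

/-- the part II radius `ρ = λ_k^{−1/4}` is at least `2` iff `λ_k ≤ 1/16`; here the sufficient direction from `λ_k^{1/4} ≤ ½`.
[cite: Dimock2013BalabanII, §3.13 Lemma 3.15 (label first) proof (A) L4509–4516 (arXiv:1212.5562v2 TeX)] -/
theorem two_le_radius_II {lam : ℝ} (hlam : 0 < lam) (hsmall : lam ^ (1 / 4 : ℝ) ≤ 1 / 2) :
    2 ≤ lam ^ (-(1 / 4 : ℝ)) := by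
  have hq : 0 < lam ^ (1 / 4 : ℝ) := Real.rpow_pos_of_pos hlam _
  rw [Real.rpow_neg hlam.le, ← one_div, le_div_iff₀ hq]
  linarith

/-- **STEP (A)'s CAUCHY BOUND** (L4509–4516: *"Thus t → E_k(X, φ⁰_{k+1,Ω′} + t𝒲_{k,Ω′}) is analytic in |t| ≤ λ_k^{−1/4} we have the
representation  δE_k(X, φ, 𝒲_{k,Ω′}) = (1/2πi)∫_{|t| = λ_k^{−1/4}} dt/(t(t−1)) E_k(X, φ + t𝒲_{k,Ω′})"*): for `f` complex differentiable
on the closed disc of radius `ρ = λ_k^{−1/4} ≥ 2` and bounded by `M` on the circle, `‖f(1) − f(0)‖ ≤ 2λ_k^{1/4}·M` (`M/(ρ−1) ≤ 2M/ρ`,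
the tree's `Dimock2015.norm_sub_le_div_of_bound_sphere`); the disc on which `hf` is asserted is `AnalyticityDomains.disc_subset_rDomain`.
[cite: Dimock2013BalabanII, §3.13 Lemma 3.15 (label first) proof (A) L4509–4516 (arXiv:1212.5562v2 TeX)] -/
theorem stepA_cauchy {f : ℂ → F} {lam M : ℝ} (hlam : 0 < lam) (hsmall : lam ^ (1 / 4 : ℝ) ≤ 1 / 2)
    (hf : DifferentiableOn ℂ f (closedBall 0 (lam ^ (-(1 / 4 : ℝ)))))
    (hM : ∀ t ∈ sphere (0 : ℂ) (lam ^ (-(1 / 4 : ℝ))), ‖f t‖ ≤ M) :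
    ‖f 1 - f 0‖ ≤ 2 * lam ^ (1 / 4 : ℝ) * M := by
  set ρ := lam ^ (-(1 / 4 : ℝ)) with hρ
  have h2 : 2 ≤ ρ := two_le_radius_II hlam hsmall
  have hρ1 : 1 < ρ := by linarith
  have hM0 : 0 ≤ M := by
    have hmem : ((ρ : ℝ) : ℂ) ∈ sphere (0 : ℂ) ρ := by
      rw [mem_sphere, dist_zero_right, Complex.norm_real, Real.norm_eq_abs, abs_of_pos (by linarith)]
    exact (norm_nonneg _).trans (hM _ hmem)
  have h3 : ‖f 1 - f 0‖ ≤ M / (ρ - 1) := norm_sub_le_div_of_bound_sphere hρ1 hf hM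
  have h4 : M / (ρ - 1) ≤ 2 * M / ρ := by
    rw [div_le_div_iff₀ (by linarith) (by linarith)]; nlinarith
  have e5 : 2 * M / ρ = 2 * lam ^ (1 / 4 : ℝ) * M := by
    rw [hρ, Real.rpow_neg hlam.le, div_inv_eq_mul]; ring
  linarith [h4]

/-- **STEP (A)'s BOUND ON `δE_k`** (L4517–4518: *"Now |E_k(X, φ)| ≤ λ_k^β e^{−κd_M(X)} for φ ∈ ℛ_k is our basic assumption, and hence
|δE_k(X, φ, 𝒲_{k,Ω′})| ≤ 𝒪(1)λ_k^{1/4+β}e^{−κd_M(X)}"*): with the circle bound `M = λ_k^βe^{−κd_M(X)}`, `‖δE_k(X)‖ ≤ 2λ_k^{1/4+β}e^{−κd_M(X)}`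
(`𝒪(1) = 2`). [cite: Dimock2013BalabanII, §3.13 Lemma 3.15 (label first) proof (A) L4517–4518 (arXiv:1212.5562v2 TeX)] -/
theorem stepA_deltaE {f : ℂ → F} {lam β κ dM : ℝ} (hlam : 0 < lam) (hsmall : lam ^ (1 / 4 : ℝ) ≤ 1 / 2)
    (hf : DifferentiableOn ℂ f (closedBall 0 (lam ^ (-(1 / 4 : ℝ)))))
    (hM : ∀ t ∈ sphere (0 : ℂ) (lam ^ (-(1 / 4 : ℝ))), ‖f t‖ ≤ lam ^ β * Real.exp (-κ * dM)) :
    ‖f 1 - f 0‖ ≤ 2 * lam ^ (1 / 4 + β) * Real.exp (-κ * dM) := by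
  have h1 := stepA_cauchy hlam hsmall hf hM
  have e1 : lam ^ (1 / 4 : ℝ) * lam ^ β = lam ^ (1 / 4 + β) := by rw [← Real.rpow_add hlam]
  calc ‖f 1 - f 0‖ ≤ 2 * lam ^ (1 / 4 : ℝ) * (lam ^ β * Real.exp (-κ * dM)) := h1
    _ = 2 * lam ^ (1 / 4 + β) * Real.exp (-κ * dM) := by rw [← e1]; ring

omit [NormedSpace ℂ F] [CompleteSpace F] in
/-- **STEP (A) ASSEMBLED** (L4519–4522: *"Altogether then |δE^+_k(X, φ, 𝒲_{k,Ω′})| ≤ 𝒪(1)λ_k^{1/4−10ε}e^{−κd_M(X)}"*): from `‖δE_k(X)‖ ≤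
2λ_k^{1/4+β}e^{−κd_M(X)}` (`stepA_deltaE`) and `‖δV_k(X)‖ ≤ K_Vλ_k^{1/4−10ε}e^{−κd_M(X)}` (Part 1 with `deltaV_exponents_scaled`; `δV_k`
lives on cubes, `d_M(□) = 0`), for `λ_k ≤ 1`, `β ≥ 0`, `ε ≥ 0`: `‖δE^+_k(X)‖ ≤ (2 + K_V)λ_k^{1/4−10ε}e^{−κd_M(X)}`.
[cite: Dimock2013BalabanII, §3.13 Lemma 3.15 (label first) proof (A) L4500–4522 (arXiv:1212.5562v2 TeX)] -/
theorem stepA_bound {δE δV : F} {lam β ε κ dM KV : ℝ} (hlam : 0 < lam) (hlam1 : lam ≤ 1) (hβ : 0 ≤ β) (hε : 0 ≤ ε)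
    (hE : ‖δE‖ ≤ 2 * lam ^ (1 / 4 + β) * Real.exp (-κ * dM))
    (hV : ‖δV‖ ≤ KV * lam ^ (1 / 4 - 10 * ε) * Real.exp (-κ * dM)) :
    ‖δE - δV‖ ≤ (2 + KV) * lam ^ (1 / 4 - 10 * ε) * Real.exp (-κ * dM) := by
  have hle : lam ^ (1 / 4 + β) ≤ lam ^ (1 / 4 - 10 * ε) :=
    Real.rpow_le_rpow_of_exponent_ge hlam hlam1 (by linarith)
  have hexp : 0 ≤ Real.exp (-κ * dM) := (Real.exp_pos _).le
  calc ‖δE - δV‖ ≤ ‖δE‖ + ‖δV‖ := norm_sub_le _ _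
    _ ≤ 2 * lam ^ (1 / 4 + β) * Real.exp (-κ * dM) + KV * lam ^ (1 / 4 - 10 * ε) * Real.exp (-κ * dM) :=
        add_le_add hE hV
    _ ≤ 2 * lam ^ (1 / 4 - 10 * ε) * Real.exp (-κ * dM) + KV * lam ^ (1 / 4 - 10 * ε) * Real.exp (-κ * dM) := by
        nlinarith [mul_le_mul_of_nonneg_right hle hexp]
    _ = (2 + KV) * lam ^ (1 / 4 - 10 * ε) * Real.exp (-κ * dM) := by ring

end StepA

/-! ## Non-vacuity -/

/-- the smallness `λ^{1/4} ≤ 1/8` is inhabited: `λ = 1/4096 = 8^{−4}`. [cite: Dimock2013, part I §4.4 Lemma 17 proof L2313 (arXiv:1108.1335v2 TeX)] -/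
example : ((1 : ℝ) / 4096) ^ (1 / 4 : ℝ) ≤ 1 / 8 := by
  rw [show (1 : ℝ) / 4096 = (1 / 8) ^ (4 : ℝ) by norm_num, ← Real.rpow_mul (by norm_num)]
  norm_num

/-- the part II smallness `λ^{1/4} ≤ 1/2` is inhabited: `λ = 1/16 = 2^{−4}`. [cite: Dimock2013BalabanII, §3.13 Lemma 3.15 proof (A) L4509 (arXiv:1212.5562v2 TeX)] -/
example : ((1 : ℝ) / 16) ^ (1 / 4 : ℝ) ≤ 1 / 2 := by
  rw [show (1 : ℝ) / 16 = (1 / 2) ^ (4 : ℝ) by norm_num, ← Real.rpow_mul (by norm_num)]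
  norm_num

end Literature.MathematicalPhysics.QuantumFieldTheory.Dimock2011to13.FluctuationShiftBound

end
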